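import Summits.QuantumFields.YangMills.Theorems.UnitScaleTiltProp7SectET3N06LeavesRecordCutCU
import Summits.QuantumFields.YangMills.Theorems.UnitScaleTiltProp7SectET3G0LayerFromThm310
import Literature.MathematicalPhysics.QuantumFieldTheory.Balaban1983to89.B9Thm313WholeLettersCutKept
import Literature.MathematicalPhysics.QuantumFieldTheory.Balaban1983to89.B9Thm313WholeCutLettersL2From3152
import HarnessLib

/-!
# Route `UnitScaleTilt`, crux «MinimiserStabilityRegPr» (stmt-QuantumFields-19200, stub EX, route (α), node N06(d = 3)) — **THE RE-CUT T³ LEAF WITH U-DEPENDENT HÖLDER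
# INTERMEDIATES AND THE BLOCK-L² RECORD DISPLAYED BY ITS KEPT FIELDS** («CU» twin of ✓`Prop7SectET3N06LeavesRecordCutKept.t313_of_pins_T3_completePairMBZk`, p640018): the
# two re-cut block-L² letters `Letters313L2Pc.vDRDG ∕ .vGDRD` DERIVED from the displayed identity (3.152), Theorem 3.1 (3.42) for G′, (3.49) for P, (3.46)₄ for G′ and
# R = ϱ(I − P) exactly as in p640018, now over the U-dependent «C»-species leaf ✓`Prop7SectET3N06LeavesRecordCutCU.t313_of_pins_T3_completePairMBCZcU` (FILE A)

Cell `ym-inputs` (D-0154 (2); HOME `pub/ym-inputs/`), seat ym-inputs-p04 gen 8 — FILE B of the located T³ option-(2) twin programme (HOME memo `T3-OPTION2-LOCATE-p04g8.md`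
346e0e9fc593a7ab §3; desk INPUT-LIST v26 §4 p04 key (ii)).  Count-neutral helper (`--supports stmt-QuantumFields-20520 --as helper`); registry untouched; THEOREMS ONLY (0 `def`,
0 `sorry`); NOTHING of [Balaban1985BackgroundPropagators] is asserted.

WHAT.  ★★★ `t313_of_pins_T3_completePairMBCZkU` — the statement of ✓`t313_of_pins_T3_completePairMBZk` (p640018 — see there for the derivation and every displayed row: `hLL2`
valued in the KEPT record `Letters313L2Pk … ∧ Letters313L2MZ …`, the data `Pp ϱ CP BD BG δG`, the rate gap `hδ₃G : δ₃ < δG`, the rows `h31 h49 hDGD hRP hT`) with EXACTLY the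
binder changes of FILE A: `bH bXH : ∀ i, (bgT3 i).Cfg → BlockNorm …`, `bHW : ∀ i, (bgT3 i).Cfg → ℝ → BlockNorm …`; `hκ hκX : ∀ i U, …`, `hκW : ∀ i U ε, …`; `hletters … (bXH i U) U`,
`hlettersD … (bH i U) U`, `hLH3 … (bH i U) … (bXH i U) U`; `hLIM` valued in `Letters313IMBC … (bHW i U) … δK (RelB i) U`.  INSIDE, VERBATIM from p640018: member facts
`Facts347` at rate `δG`, exponent `α := (δG − δ₃)∕(3δG)`, row sum at margin `σ := (δG − δ₃)∕3` from ✓`Prop7SectET3G0LayerFromThm310.lemma21Pack_geo9K` ∕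
`B9GeoLemma21KLevelV1.rowSum261_geo9K` above an M-threshold (ZERO geometry hypotheses); the two letters by Track A's `B9Thm313WholeCutLettersL2From3152.vDRDG_of_ids3152 ∕
vGDRD_of_ids3152`; the kept record raised to `B₄⋆ := max B₄ (ϱ·(ℓ+1)·(BD + CP·(ℓ+1)·BG·c⁺))` by `Letters313L2Pk.mono` and the private constant-monotonicity below;
`Letters313L2Pc.of_kept`; then FILE A BY NAME at `B₄⋆` and `M₁⋆`.  The L² material is U-free and untouched by the U-dependence of the Hölder intermediates.
Conclusion `B9.Thm313Printed c35 geo9K bgT3 GG HasRWExp PosDefK` BYTE-IDENTICAL; ✓p640018 stays as it is (additive twin).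
NOTE (memo §3): this file ALREADY displays `h31 ∕ h49 ∕ hRP` in the shapes the option-(2) pins engines (✓`B9Thm313WholeCutLettersAtPinsP.letters313Zc_bHZKPG_of_pins`,
`.pWE_bHZKPG_of_pins`) consume — FILE C adds no second copy of them.
L-FLOOR (RULING g26-№20): none beyond the parent's.
HONEST SCOPE: bookkeeping over Track A's landed schemas and derivations; every analytic row stays a displayed HYPOTHESIS about the genuine operators (incl. the XL item
`Thm33G0` and `Letters313IMBC`); N06(d = 3) NOT discharged; nothing here claims EX, the crux, V3∕R3, d = 4 or the mass gap; YM₃ on T³ = ladder rung R3 (RECORD), not the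
Clay problem.

References: T. Bałaban, CMP **99** (1985) 389–434 [Balaban1985BackgroundPropagators] (Thm 3.13 p.426, (3.152)–(3.153) pp.425–426, Thm 3.1 (3.42)–(3.46) pp.397–398,
(3.49) p.399, p.391); CMP **96** (1984) 223–250 [Balaban1984PropagatorsII] (Lemma 2.1 (2.59)–(2.61) pp.233–234, (2.51)–(2.56) pp.232–233).
-/

set_option autoImplicit false

noncomputable section

open scoped Matrix.Norms.L2Operator

namespace Summit.QuantumFields.YangMills.Theorems.Prop7SectET3N06LeavesRecordCutKeptCU

open Literature.MathematicalPhysics.QuantumFieldTheory.Balaban1983to89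
open Finset B6RandomWalk B6RandomWalkHom B9Thm34Ext B9Thm37GlueCor36 B11SectG B9SectDSup B9Thm37AllNorms
open B9Thm37AllNormsInstances B9FromB6 B9FromB6ModelSignsOn B9SectBStepWhole B9Thm312Whole B9Thm312WholeLeaf B9Thm312WholeLeft B9Thm313Whole
open B9Thm313WholeLeft B9Thm312WholeLeafLeftGlob B9Ineq347CoReading B9SectCDiffDict B9CoRealizesRel B9Thm37Glue B9SectDL2Decay B9RWSums343Holder
open B9RWSumsReadsRel B9RWSumsReadsNbr B9Ineq347 B9Thm312WholeClasses B9Thm312WholeL2 B9Thm312WholeBlocksRel B9Thm312WholeBlocksNbr B9Thm313WholeLeafRel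
open B9Thm312WholeHolder B9Thm312WholeHHolder B9Thm313WholeHolder B9Thm313WholeL2G B9Thm313WholeL2GP B9Thm313WholeInput B9Thm313WholeBlocksNbr B9Thm312WholeLeafAll
open B9RWSums346SecondDiff B9Thm313WholeBlocksNbrRec B9RWSums344InputFam B9Thm312WholeDir B9Thm312WholeBlocksPairM B9Thm313WholeDir B9Thm313WholeDirInput B9Thm313WholeBlocksPairM
open B9Thm313WholeLeafCompletePairM B9Thm312WholeDirB B9Thm313WholeDirInputB B9Thm313WholeBlocksPairMB B9Thm313WholeLeafCompletePairMB B9Thm313WholeBlocksPairMZ B9Thm313WholeBlocksPairMBZ B9Thm313WholeLeafRelZ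
open B9Thm312WholeHZ B9Thm313WholeZ B9Thm313WholeLeftZ B9Thm313WholeHolderZ B9Thm313WholeInputZ B9Thm313WholeDirZ B9Thm313WholeDirInputZ B9Thm313WholeDirInputBZ
open B9Thm313WholeL2GZ B9Thm313WholeL2GPZ B9Thm313WholeDirL2Z B9Thm313WholeLeafCompletePairMBZ
open B9PerturbationMajorantAlgebra (Thm31GpMaj Proj349Maj)
open B9RWSums343to347Whole (Facts347)
open B9Thm313WholeRgdFrom3152 (Ids3152)
open B9Thm313WholeLettersCut (Letters313Zc Letters313HZc Letters313L2Pc)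
open B9Thm313WholeLettersCutKept (Letters313L2Pk)
open B9Thm313WholeCutLettersL2From3152 (vDRDG_of_ids3152 vGDRD_of_ids3152)
open B6KLevelCensusIndexV1 (KIdx)
open B9GeoNormsKLevelV1 (geo9K)
open B9GeoLemma21KLevelV1 (rowSum261_geo9K)
open B9CoRealizesRelAtLetters (RelB)
open Summit.QuantumFields.YangMills.Theorems.Prop7SectET3Members (hd3)
open Summit.QuantumFields.YangMills.Theorems.Prop7SectET3Geometry (geoOK_geo9K)
open Summit.QuantumFields.YangMills.Theorems.Prop7SectET3BgClass (bgT3)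
open Summit.QuantumFields.YangMills.Theorems.Prop7SectET3N06LeavesRecordCutCU (t313_of_pins_T3_completePairMBCZcU)
open B9Thm313WholeDirInputBC (Letters313IMBC)
open Summit.QuantumFields.YangMills.Theorems.Prop7SectET3G0LayerFromThm310 (lemma21Pack_geo9K)

variable {ℓ : ℕ} {hL : Odd (ℓ + 1) ∧ 1 < ℓ + 1} {b₀ b₁ : ℝ} {c35 : ℝ}

/-- the direction-indexed block-L² letters `Letters313L2MZ` at a LARGER constant (`B₄ ≤ B₄'`; the weights `v_Z(y′)·L^{j′}η` are nonnegative) — the constant twin of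
`B9Thm313WholeDirL2Z.letters313L2MZ_mono` (which moves the rate); private bookkeeping for meeting the derived letters' constant. [cite: Balaban1985BackgroundPropagators, (3.46) p.398 (bookkeeping)] -/
private theorem letters313L2MZ_mono_const {g : B9.Geometry} {B : B9.Backgrounds} {X Y Z W P : Type} [Fintype X] [Fintype Z] [Fintype W] [Fintype g.Site]
    {R₀ : ℝ} {H₀ : Prop} {𝔬 : Ops g B X Y Z W} {Dd Dds : B.Cfg → P → Module.End ℝ (X → ℝ)} {B₄ B₄' δ : ℝ} {U : B.Cfg}
    (hG : GeoOK g) (hBB : B₄ ≤ B₄') {vZ : g.Site → ℝ} {hvZ : ∀ y, 0 < vZ y} (h : Letters313L2MZ 𝔬 Dd Dds R₀ H₀ B₄ δ vZ hvZ U) :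
    Letters313L2MZ 𝔬 Dd Dds R₀ H₀ B₄' δ vZ hvZ U := by
  have hE : ∀ y y' : g.Site, 0 ≤ Real.exp (-(δ * g.dist y y')) := fun _ _ => Real.exp_nonneg _
  have hv : ∀ y : g.Site, 0 ≤ vZ y * g.len y := fun y => mul_nonneg (hvZ y).le (hG.lenle y)
  exact
    { dGDvd := fun ν => (h.dGDvd ν).mono fun y y' => mul_le_mul_of_nonneg_right hBB (hE y y')
      dGQsd := fun ν => (h.dGQsd ν).mono fun y y' => mul_le_mul_of_nonneg_right (mul_le_mul_of_nonneg_right hBB (hv y')) (hE y y')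
      rgdDd := fun μ => (h.rgdDd μ).mono fun y y' => mul_le_mul_of_nonneg_right hBB (hE y y') }

/-- ★★★ **THEOREM 3.13 AS THE WHOLE PRINTED LEAF, RE-CUT «C» SPECIES WITH U-DEPENDENT HÖLDER INTERMEDIATES, THE BLOCK-L² RECORD DISPLAYED BY ITS KEPT FIELDS**
(«CU» twin of ✓`Prop7SectET3N06LeavesRecordCutKept.t313_of_pins_T3_completePairMBZk`: statement of ✓`Prop7SectET3N06LeavesRecordCutCU.t313_of_pins_T3_completePairMBCZcU` —
see there for every binder; `bH i U ∕ bXH i U ∕ bHW i U` read per configuration, `hLIM` in `Letters313IMBC … (RelB i) U` — with `hLL2` valued in dag-n06-d's kept sub-record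
`Letters313L2Pk … B₄ δ₃ ∧ Letters313L2MZ … B₄ δ₃` (NO `vDRDG ∕ vGDRD`), and the NEW displayed printed rows from which those two letters are DERIVED by
`B9Thm313WholeCutLettersL2From3152.vDRDG_of_ids3152 ∕ vGDRD_of_ids3152`: `h31` (Theorem 3.1 (3.42) for G′ at (BG, δG)), `h49` ((3.49) for `Pp` at (CP, δG)), `hDGD`
((3.46)₄ for G′ at (BD, δG)), `hRP` (R = ϱ•(I − P)), `hT` (the transposition pairs), the free data `Pp ϱ CP BD BG δG` with signs and ONE rate gap `hδ₃G : δ₃ < δG`; the identity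
(3.152) is the parent's displayed `h152`).  DISCHARGED INSIDE: the member facts and the row sum at `geo9K` above a threshold (`lemma21Pack_geo9K`, `rowSum261_geo9K`), the
constant of the derived letters (met by `Letters313L2Pk.mono` at `max B₄ (ϱ(ℓ+1)(BD + CP(ℓ+1)BG·c⁺))`), the re-assembly `Letters313L2Pc.of_kept`; then the parent BY NAME.
Conclusion: `B9.Thm313Printed c35 geo9K bgT3 GG HasRWExp PosDefK`, byte-identical.  Nothing of print asserted; NOT a discharge of N06(d = 3).
[cite: Balaban1985BackgroundPropagators, Thm 3.13 p.426, (3.152)-(3.153) pp.425-426, Thm 3.1 (3.42)+(3.46) pp.397-398, (3.49) p.399, p.391, Thm 3.12 p.423; Balaban1984PropagatorsII, (2.51)-(2.56) pp.232-233, Lemma 2.1 (2.59)-(2.61) pp.233-234] -/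
theorem t313_of_pins_T3_completePairMBCZkU [∀ i : KIdx 2 ℓ hd3 hL b₀ b₁, Fintype (geo9K i).Site] [∀ i : KIdx 2 ℓ hd3 hL b₀ b₁, DecidableEq (geo9K i).Site]
    {X Y Z W PX PY : KIdx 2 ℓ hd3 hL b₀ b₁ → Type} {P : Type} [∀ i, Fintype (X i)] [∀ i, DecidableEq (X i)] [∀ i, Fintype (Y i)]
    [∀ i, Fintype (Z i)] [∀ i, Fintype (W i)] [∀ i, Fintype (PX i)] [∀ i, Fintype (PY i)] [Fintype P]
    (𝔬 : ∀ i : KIdx 2 ℓ hd3 hL b₀ b₁, Ops (geo9K i) (bgT3 i) (X i) (Y i) (Z i) (W i)) (H₀ : KIdx 2 ℓ hd3 hL b₀ b₁ → Prop)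
    (GG : ∀ i : KIdx 2 ℓ hd3 hL b₀ b₁, B9.KernelFamily (geo9K i) (bgT3 i)) (bH : ∀ i : KIdx 2 ℓ hd3 hL b₀ b₁, (bgT3 i).Cfg → BlockNorm (toB6 (geo9K i) 1 (H₀ i)) (W i → ℝ))
    (𝔭 : ∀ i : KIdx 2 ℓ hd3 hL b₀ b₁, HolderProbes (geo9K i) (bgT3 i) (X i) (Y i) (PX i) (PY i))
    (bHX : ∀ i : KIdx 2 ℓ hd3 hL b₀ b₁, ℝ → BlockNorm (toB6 (geo9K i) 1 (H₀ i)) (X i → ℝ))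
    (Gp : ∀ i : KIdx 2 ℓ hd3 hL b₀ b₁, (bgT3 i).Cfg → Module.End ℝ (W i → ℝ))
    (bXH : ∀ i : KIdx 2 ℓ hd3 hL b₀ b₁, (bgT3 i).Cfg → BlockNorm (toB6 (geo9K i) 1 (H₀ i)) (X i → ℝ))
    (Pp : ∀ i : KIdx 2 ℓ hd3 hL b₀ b₁, (bgT3 i).Cfg → Module.End ℝ (W i → ℝ))
    (Dd Dds : ∀ i : KIdx 2 ℓ hd3 hL b₀ b₁, (bgT3 i).Cfg → P → Module.End ℝ (X i → ℝ))
    (bHW : ∀ i : KIdx 2 ℓ hd3 hL b₀ b₁, (bgT3 i).Cfg → ℝ → BlockNorm (toB6 (geo9K i) 1 (H₀ i)) (W i → ℝ))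
    (ev : ∀ i : KIdx 2 ℓ hd3 hL b₀ b₁, (geo9K i).Loc → X i → ℝ) (evY : ∀ i : KIdx 2 ℓ hd3 hL b₀ b₁, (geo9K i).Loc → Y i → ℝ)
    (r Cev θ₁ θD θ₂ r₁ B₀ B₂ B₄ δ₀ δK σ ρ a₁ M₁ B₃ δ₃ ρ' α κ₀ : ℝ) (ϱ CP BD BG δG : ℝ) (Bh Bi Bq BhD Bx Bd θH θI θV Br : ℝ → ℝ)
    (Bi2 Bd2 : ℝ → ℝ → ℝ)
    (hθ₁ : 0 ≤ θ₁) (hθD : 0 ≤ θD) (hθH : ∀ β, 0 ≤ β → β < 1 → 0 ≤ θH β) (hθI : ∀ ε, 0 < ε → 0 ≤ θI ε) (hθ₂ : 0 ≤ θ₂)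
    (hθV : ∀ ε, 0 < ε → 0 ≤ θV ε) (hr₁ : 0 ≤ r₁) (hB₀ : 0 ≤ B₀) (hB₂ : 0 ≤ B₂)
    (hB₃ : 0 ≤ B₃) (hB₄ : 0 ≤ B₄) (hBr : ∀ ε, 0 < ε → 0 ≤ Br ε) (hσ : 0 < σ) (hρ' : 0 < ρ') (hρ'ρ : ρ' + 3 * σ ≤ ρ) (hρ'ρ₅ : ρ' + 5 * σ ≤ ρ)
    (hσρ' : 3 * σ < (1 - α) * ρ')
    (hρS : ρ ≤ δ₀) (hρ₃ : ρ ≤ δ₃) (hρδ : ρ + σ ≤ δK) (ha₁ : 0 < a₁) (hM₁ : 0 < M₁)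
    (hα0 : 0 < α) (hα1 : α < 1) (hBi : ∀ ε, 0 < ε → ε ≤ 1 → 0 ≤ Bi ε) (hBd : ∀ ε, 0 < ε → ε ≤ 1 → 0 ≤ Bd ε)
    (hBi2 : ∀ ε β, 0 < ε → ε ≤ 1 → 0 ≤ β → β < 1 → 0 ≤ Bi2 ε β) (hBd2 : ∀ ε β, 0 < ε → ε ≤ 1 → 0 ≤ β → β < 1 → 0 ≤ Bd2 ε β)
    (hBh : ∀ β, 0 ≤ β → β < 1 → 0 ≤ Bh β) (hBq : ∀ β, 0 ≤ β → β < 1 → 0 ≤ Bq β) (hBhD : ∀ β, 0 ≤ β → β < 1 → 0 ≤ BhD β)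
    (hBx : ∀ β, 0 ≤ β → β < 1 → 0 ≤ Bx β) (hCev : 0 ≤ Cev)
    (hϱ : 0 ≤ ϱ) (hCP : 0 ≤ CP) (hBD : 0 ≤ BD) (hBG : 0 ≤ BG) (hδ₃G : δ₃ < δG)
    (hκ : ∀ (i : KIdx 2 ℓ hd3 hL b₀ b₁) (U : (bgT3 i).Cfg), (bH i U).κ ≤ κ₀)
    (hκW : ∀ (i : KIdx 2 ℓ hd3 hL b₀ b₁) (U : (bgT3 i).Cfg) (ε : ℝ), (bHW i U ε).κ ≤ κ₀)
    (hκX : ∀ (i : KIdx 2 ℓ hd3 hL b₀ b₁) (U : (bgT3 i).Cfg), (bXH i U).κ ≤ κ₀)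
    (hcoR : ∀ (i : KIdx 2 ℓ hd3 hL b₀ b₁) (U : (bgT3 i).Cfg),
      CoRealizesRel (GG i) 0 U (RelB i) (𝔬 i).blk (𝔬 i).blk (ev i) ((𝔬 i).GG U) ∧
      CoRealizesRel (GG i) 2 U (RelB i) (𝔬 i).blk (𝔬 i).blkY (evY i) ((𝔬 i).GG U ∘ₗ (𝔬 i).Dstar U))
    (hco1R : ∀ (i : KIdx 2 ℓ hd3 hL b₀ b₁) (U : (bgT3 i).Cfg), CoRealizesRel (GG i) 1 U (RelB i) (𝔬 i).blkY (𝔬 i).blk (ev i) ((𝔬 i).D U ∘ₗ (𝔬 i).GG U))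
    (hcoG : ∀ (i : KIdx 2 ℓ hd3 hL b₀ b₁) (U : (bgT3 i).Cfg),
      CoReadsGlob (GG i) 0 U (𝔬 i).blk (𝔬 i).blk (ev i) ((𝔬 i).GG U) ∧
      CoReadsGlob (GG i) 1 U (𝔬 i).blkY (𝔬 i).blk (ev i) ((𝔬 i).D U ∘ₗ (𝔬 i).GG U) ∧
      CoReadsGlob (GG i) 2 U (𝔬 i).blk (𝔬 i).blkY (evY i) ((𝔬 i).GG U ∘ₗ (𝔬 i).Dstar U))
    (hsymGG : ∀ i : KIdx 2 ℓ hd3 hL b₀ b₁, M₁ ≤ (geo9K i).M → ∀ α₀ : ℝ, 0 < α₀ → (geo9K i).M * α₀ ≤ a₁ →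
      ∀ U : (bgT3 i).Cfg, (bgT3 i).Reg335 c35 α₀ U → (bgT3 i).Reg336 c35 α₀ U →
        IsTransposePair ((𝔬 i).GG U) ((𝔬 i).GG U) ∧ IsTransposePair ((𝔬 i).D U ∘ₗ (𝔬 i).GG U) ((𝔬 i).GG U ∘ₗ (𝔬 i).Dstar U))
    (hl2N : ∀ (i : KIdx 2 ℓ hd3 hL b₀ b₁) (U : (bgT3 i).Cfg),
      L2ReadsNbr (R := (1 : ℝ)) (H := H₀ i) (GG i) 0 U (RelB i) r Cev (𝔬 i).blk (𝔬 i).blk (ev i) ((𝔬 i).GG U) ∧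
      L2ReadsNbr (R := (1 : ℝ)) (H := H₀ i) (GG i) 1 U (RelB i) r Cev (𝔬 i).blkY (𝔬 i).blk (ev i) ((𝔬 i).D U ∘ₗ (𝔬 i).GG U) ∧
      L2ReadsNbr (R := (1 : ℝ)) (H := H₀ i) (GG i) 2 U (RelB i) r Cev (𝔬 i).blk (𝔬 i).blkY (evY i) ((𝔬 i).GG U ∘ₗ (𝔬 i).Dstar U) ∧
      L2ReadsNbr (R := (1 : ℝ)) (H := H₀ i) (GG i) 3 U (RelB i) r Cev ((𝔬 i).blk ∘ Prod.fst) (𝔬 i).blk (ev i)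
        (familyOp (fun q : P × P => Dd i U q.1 ∘ₗ ((𝔬 i).GG U ∘ₗ Dds i U q.2))) ∧
      L2ReadsNbr (R := (1 : ℝ)) (H := H₀ i) (GG i) 4 U (RelB i) r Cev ((𝔬 i).blk ∘ Prod.fst) (𝔬 i).blk (ev i)
        (familyOp (fun q : P × P => (Dd i U q.1 ∘ₗ Dd i U q.2) ∘ₗ (𝔬 i).GG U)) ∧
      L2ReadsNbr (R := (1 : ℝ)) (H := H₀ i) (GG i) 5 U (RelB i) r Cev ((𝔬 i).blk ∘ Prod.fst) (𝔬 i).blk (ev i)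
        (familyOp (fun q : P × P => (𝔬 i).GG U ∘ₗ (Dds i U q.1 ∘ₗ Dds i U q.2))))
    (hH1N : ∀ (i : KIdx 2 ℓ hd3 hL b₀ b₁) (U : (bgT3 i).Cfg),
      H1ReadsNbr (GG i) U (𝔭 i) (RelB i) r (𝔬 i).blk (𝔬 i).blkY (ev i) (evY i) ((𝔬 i).D U ∘ₗ (𝔬 i).GG U)
        ((𝔬 i).GG U ∘ₗ (𝔬 i).Dstar U))
    (hIF : ∀ (i : KIdx 2 ℓ hd3 hL b₀ b₁) (U : (bgT3 i).Cfg),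
      InputReadsFam (GG i) U (bHX i) r ((𝔬 i).blk ∘ Prod.fst) ((𝔭 i).blkPX ∘ Prod.fst) (fun β => sliceProbe ((𝔭 i).ΦX U β)) (ev i)
        (familyOp (fun q : P × P => Dd i U q.1 ∘ₗ ((𝔬 i).GG U ∘ₗ Dds i U q.2))))
    (hmodel : ∀ i : KIdx 2 ℓ hd3 hL b₀ b₁, M₁ ≤ (geo9K i).M → ∀ α₀ : ℝ, 0 < α₀ → (geo9K i).M * α₀ ≤ a₁ →
      ∀ U : (bgT3 i).Cfg, (bgT3 i).Reg335 c35 α₀ U → (bgT3 i).Reg336 c35 α₀ U →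
        Thm33G0 (𝔬 i) 1 (H₀ i) B₀ δ₀ U ∧
        Step (𝔬 i) 1 (H₀ i) (geoOK_geo9K i).lenle 1 (θ₁ * ((geo9K i).M * α₀)) δK U ∧
        Step (𝔬 i) 1 (H₀ i) (geoOK_geo9K i).lenle 2 (θ₁ * ((geo9K i).M * α₀)) δK U ∧
        FormSmall (𝔬 i) (r₁ * ((geo9K i).M * α₀)) U ∧ Identities (𝔬 i) U)
    (hleft : ∀ i : KIdx 2 ℓ hd3 hL b₀ b₁, M₁ ≤ (geo9K i).M → ∀ α₀ : ℝ, 0 < α₀ → (geo9K i).M * α₀ ≤ a₁ →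
      ∀ U : (bgT3 i).Cfg, (bgT3 i).Reg335 c35 α₀ U → (bgT3 i).Reg336 c35 α₀ U →
        LeftStep (𝔬 i) 1 (H₀ i) (geoOK_geo9K i).lenle B₀ δ₀ (θD * ((geo9K i).M * α₀)) δK U)
    (wZ : ∀ i : KIdx 2 ℓ hd3 hL b₀ b₁, (geo9K i).Site → ℝ) (hwZ : ∀ i y, 0 < wZ i y)
    (hletters : ∀ i : KIdx 2 ℓ hd3 hL b₀ b₁, M₁ ≤ (geo9K i).M → ∀ α₀ : ℝ, 0 < α₀ → (geo9K i).M * α₀ ≤ a₁ →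
      ∀ U : (bgT3 i).Cfg, (bgT3 i).Reg335 c35 α₀ U → (bgT3 i).Reg336 c35 α₀ U →
        Letters313Zc (𝔬 i) (Gp i) 1 (H₀ i) (geoOK_geo9K i) (wZ i) (hwZ i) B₃ δ₃ (bXH i U) U)
    (h152 : ∀ i : KIdx 2 ℓ hd3 hL b₀ b₁, M₁ ≤ (geo9K i).M → ∀ α₀ : ℝ, 0 < α₀ → (geo9K i).M * α₀ ≤ a₁ →
      ∀ U : (bgT3 i).Cfg, (bgT3 i).Reg335 c35 α₀ U → (bgT3 i).Reg336 c35 α₀ U → Ids3152 (𝔬 i) (Gp i) U)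
    -- ======== NEW: Theorem 3.1 for G′, (3.49) for P, (3.46)₄ for G′, R = ϱ(I − P), the transposes (the inputs of `vDRDG_of_ids3152 ∕ vGDRD_of_ids3152`) ========
    (h31 : ∀ i : KIdx 2 ℓ hd3 hL b₀ b₁, M₁ ≤ (geo9K i).M → ∀ α₀ : ℝ, 0 < α₀ → (geo9K i).M * α₀ ≤ a₁ →
      ∀ U : (bgT3 i).Cfg, (bgT3 i).Reg335 c35 α₀ U → (bgT3 i).Reg336 c35 α₀ U →
        Thm31GpMaj (𝔬 i).blkW (𝔬 i).blk (Gp i U) ((𝔬 i).Dv U) ((𝔬 i).Dvstar U) 1 (H₀ i) BG δG)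
    (h49 : ∀ i : KIdx 2 ℓ hd3 hL b₀ b₁, M₁ ≤ (geo9K i).M → ∀ α₀ : ℝ, 0 < α₀ → (geo9K i).M * α₀ ≤ a₁ →
      ∀ U : (bgT3 i).Cfg, (bgT3 i).Reg335 c35 α₀ U → (bgT3 i).Reg336 c35 α₀ U →
        Proj349Maj (𝔬 i).blkW (𝔬 i).blk (Pp i U) ((𝔬 i).Dv U) ((𝔬 i).Dvstar U) 1 (H₀ i) CP δG)
    (hDGD : ∀ i : KIdx 2 ℓ hd3 hL b₀ b₁, M₁ ≤ (geo9K i).M → ∀ α₀ : ℝ, 0 < α₀ → (geo9K i).M * α₀ ≤ a₁ →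
      ∀ U : (bgT3 i).Cfg, (bgT3 i).Reg335 c35 α₀ U → (bgT3 i).Reg336 c35 α₀ U →
        BlockBd (g := toB6 (geo9K i) 1 (H₀ i)) (𝔬 i).blk (𝔬 i).blk ((𝔬 i).Dv U ∘ₗ Gp i U ∘ₗ (𝔬 i).Dvstar U)
          (fun (y y' : (geo9K i).Site) => BD * Real.exp (-(δG * (geo9K i).dist y y'))))
    (hRP : ∀ i : KIdx 2 ℓ hd3 hL b₀ b₁, M₁ ≤ (geo9K i).M → ∀ α₀ : ℝ, 0 < α₀ → (geo9K i).M * α₀ ≤ a₁ →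
      ∀ U : (bgT3 i).Cfg, (bgT3 i).Reg335 c35 α₀ U → (bgT3 i).Reg336 c35 α₀ U → (𝔬 i).R U = ϱ • (LinearMap.id - Pp i U))
    (hT : ∀ i : KIdx 2 ℓ hd3 hL b₀ b₁, M₁ ≤ (geo9K i).M → ∀ α₀ : ℝ, 0 < α₀ → (geo9K i).M * α₀ ≤ a₁ →
      ∀ U : (bgT3 i).Cfg, (bgT3 i).Reg335 c35 α₀ U → (bgT3 i).Reg336 c35 α₀ U →
        IsTransposePair (Gp i U) (Gp i U) ∧ IsTransposePair ((𝔬 i).Dv U) ((𝔬 i).Dvstar U) ∧ IsTransposePair (Pp i U) (Pp i U))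
    -- ======== the parent's remaining rows, VERBATIM ========
    (hlettersD : ∀ i : KIdx 2 ℓ hd3 hL b₀ b₁, M₁ ≤ (geo9K i).M → ∀ α₀ : ℝ, 0 < α₀ → (geo9K i).M * α₀ ≤ a₁ →
      ∀ U : (bgT3 i).Cfg, (bgT3 i).Reg335 c35 α₀ U → (bgT3 i).Reg336 c35 α₀ U →
        Letters313DZ (𝔬 i) 1 (H₀ i) (geoOK_geo9K i) (wZ i) (hwZ i) B₃ δ₃ (bH i U) U ∧
          Letters313DMZ (𝔬 i) (𝔭 i) (Dd i) 1 (H₀ i) (geoOK_geo9K i) (wZ i) (hwZ i) B₃ Bq δ₃ (bH i U) U)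
    (hG0C : ∀ i : KIdx 2 ℓ hd3 hL b₀ b₁, M₁ ≤ (geo9K i).M → ∀ α₀ : ℝ, 0 < α₀ → (geo9K i).M * α₀ ≤ a₁ →
      ∀ U : (bgT3 i).Cfg, (bgT3 i).Reg335 c35 α₀ U → (bgT3 i).Reg336 c35 α₀ U →
        Thm33G0Dir (𝔬 i) (𝔭 i) (Dd i) (Dds i) 1 (H₀ i) (bHX i) B₀ Bh Bi Bi2 δ₀ U ∧
          Thm33G0DirR (𝔬 i) (Dds i) 1 (H₀ i) B₀ δ₀ U)
    (hstepD : ∀ i : KIdx 2 ℓ hd3 hL b₀ b₁, M₁ ≤ (geo9K i).M → ∀ α₀ : ℝ, 0 < α₀ → (geo9K i).M * α₀ ≤ a₁ →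
      ∀ U : (bgT3 i).Cfg, (bgT3 i).Reg335 c35 α₀ U → (bgT3 i).Reg336 c35 α₀ U →
        StepDirB (𝔬 i) (𝔭 i) (Dd i) (Dds i) 1 (H₀ i) (bHX i) (geoOK_geo9K i).lenle (θD * ((geo9K i).M * α₀))
          (fun β => θH β * ((geo9K i).M * α₀)) (fun ε => θI ε * ((geo9K i).M * α₀)) δK U)
    (hLHH : ∀ i : KIdx 2 ℓ hd3 hL b₀ b₁, M₁ ≤ (geo9K i).M → ∀ α₀ : ℝ, 0 < α₀ → (geo9K i).M * α₀ ≤ a₁ →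
      ∀ U : (bgT3 i).Cfg, (bgT3 i).Reg335 c35 α₀ U → (bgT3 i).Reg336 c35 α₀ U →
        LettersHHZ (𝔬 i) (𝔭 i) 1 (H₀ i) (geoOK_geo9K i).lenle
          (weightNorm (BlockNorm.ofBlocks (toB6 (geo9K i) 1 (H₀ i)) (𝔬 i).blkZ) (wZ i) fun y => (hwZ i y).le) Bq δ₃ U)
    (hLH3 : ∀ i : KIdx 2 ℓ hd3 hL b₀ b₁, M₁ ≤ (geo9K i).M → ∀ α₀ : ℝ, 0 < α₀ → (geo9K i).M * α₀ ≤ a₁ →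
      ∀ U : (bgT3 i).Cfg, (bgT3 i).Reg335 c35 α₀ U → (bgT3 i).Reg336 c35 α₀ U →
        Letters313HZc (𝔬 i) (𝔭 i) (Gp i) 1 (H₀ i) (geoOK_geo9K i) (wZ i) (hwZ i) (bH i U) BhD Bx δ₃ (bXH i U) U)
    (hG0L2 : ∀ i : KIdx 2 ℓ hd3 hL b₀ b₁, M₁ ≤ (geo9K i).M → ∀ α₀ : ℝ, 0 < α₀ → (geo9K i).M * α₀ ≤ a₁ →
      ∀ U : (bgT3 i).Cfg, (bgT3 i).Reg335 c35 α₀ U → (bgT3 i).Reg336 c35 α₀ U →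
        Thm33G0L2M (𝔬 i) (Dd i) (Dds i) 1 (H₀ i) B₂ δ₀ U)
    (hstepL2 : ∀ i : KIdx 2 ℓ hd3 hL b₀ b₁, M₁ ≤ (geo9K i).M → ∀ α₀ : ℝ, 0 < α₀ → (geo9K i).M * α₀ ≤ a₁ →
      ∀ U : (bgT3 i).Cfg, (bgT3 i).Reg335 c35 α₀ U → (bgT3 i).Reg336 c35 α₀ U →
        StepL2 (𝔬 i) 1 (H₀ i) (θ₂ * ((geo9K i).M * α₀)) δK U)
    (vZ : ∀ i : KIdx 2 ℓ hd3 hL b₀ b₁, (geo9K i).Site → ℝ) (hvZ : ∀ i y, 0 < vZ i y)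
    -- ======== RE-CUT: the block-L² record by its KEPT fields ========
    (hLL2 : ∀ i : KIdx 2 ℓ hd3 hL b₀ b₁, M₁ ≤ (geo9K i).M → ∀ α₀ : ℝ, 0 < α₀ → (geo9K i).M * α₀ ≤ a₁ →
      ∀ U : (bgT3 i).Cfg, (bgT3 i).Reg335 c35 α₀ U → (bgT3 i).Reg336 c35 α₀ U →
        Letters313L2Pk (𝔬 i) (Dd i) (Dds i) 1 (H₀ i) B₄ δ₃ (vZ i) (hvZ i) U ∧
          Letters313L2MZ (𝔬 i) (Dd i) (Dds i) 1 (H₀ i) B₄ δ₃ (vZ i) (hvZ i) U)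
    (hLIM : ∀ i : KIdx 2 ℓ hd3 hL b₀ b₁, M₁ ≤ (geo9K i).M → ∀ α₀ : ℝ, 0 < α₀ → (geo9K i).M * α₀ ≤ a₁ →
      ∀ U : (bgT3 i).Cfg, (bgT3 i).Reg335 c35 α₀ U → (bgT3 i).Reg336 c35 α₀ U →
        Letters313IMBC (𝔬 i) (𝔭 i) (Dd i) (Dds i) 1 (H₀ i) (geoOK_geo9K i).lenle (bHX i) (bHW i U) Br (fun ε => θV ε * ((geo9K i).M * α₀))
          Bd Bd2 δ₃ δK (RelB i) U)
    (HasRWExp : ∀ i : KIdx 2 ℓ hd3 hL b₀ b₁, B9.KernelFamily (geo9K i) (bgT3 i) → (bgT3 i).Cfg → ℝ → Prop)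
    (PosDefK : ∀ i : KIdx 2 ℓ hd3 hL b₀ b₁, B9.KernelFamily (geo9K i) (bgT3 i) → (bgT3 i).Cfg → Prop)
    (hpinE : ∀ i : KIdx 2 ℓ hd3 hL b₀ b₁, HasRWExp i = HasRWExpOfOps (𝔬 i)) (hpinK : ∀ i : KIdx 2 ℓ hd3 hL b₀ b₁, PosDefK i = PosDefKOfOps (𝔬 i)) :
    B9.Thm313Printed c35 geo9K bgT3 GG HasRWExp PosDefK := by
  classical
  -- the letters' rate is positive (ρ′ > 0, ρ′ + 3σ ≤ ρ ≤ δ₃) and strictly below the G′-material's rate δG: room for two (2.60) shifts and one margin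
  have hδ₃pos : 0 < δ₃ := by linarith
  have hδGpos : 0 < δG := hδ₃pos.trans hδ₃G
  obtain ⟨τ, hτdef⟩ : ∃ τ : ℝ, τ = (δG - δ₃) / 3 := ⟨_, rfl⟩
  have hτpos : 0 < τ := by rw [hτdef]; exact div_pos (by linarith) (by norm_num)
  have hτ3 : 3 * τ = δG - δ₃ := by rw [hτdef]; ring
  obtain ⟨αf, hαfdef⟩ : ∃ αf : ℝ, αf = τ / δG := ⟨_, rfl⟩
  have hαfpos : 0 < αf := by rw [hαfdef]; exact div_pos hτpos hδGpos
  have hαfδ : αf * δG = τ := by rw [hαfdef]; exact div_mul_cancel₀ τ hδGpos.ne'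
  have hαf2 : αf < 1 / 2 := by
    rw [hαfdef, div_lt_iff₀ hδGpos]
    linarith
  -- the member facts at (δG, αf) and the row sum at margin τ, above one M-threshold (no geometry hypotheses)
  obtain ⟨Mth, -, -, hfacts⟩ :=
    lemma21Pack_geo9K (ℓ := ℓ) (hL := hL) (b₀ := b₀) (b₁ := b₁) H₀ (αF := 1 / 2) hαfpos hαf2 hδGpos (by norm_num) (by norm_num)
  obtain ⟨ML, c, hrow⟩ := rowSum261_geo9K (d := 2) (ℓ := ℓ) (hd := hd3) (hL := hL) (b₀ := b₀) (b₁ := b₁) τ hτpos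
  have hrow' : ∀ i : KIdx 2 ℓ hd3 hL b₀ b₁, ML ≤ (geo9K i).M → RowSum (toB6 (geo9K i) 1 (H₀ i)) τ (max c 0) :=
    fun i hM y => (hrow i hM y).trans (le_max_left _ _)
  have hc' : (0 : ℝ) ≤ max c 0 := le_max_right _ _
  -- the common constant of the re-assembled block-L² record and the common threshold
  obtain ⟨B₄s, hB₄sdef⟩ : ∃ B₄s : ℝ, B₄s = max B₄ (ϱ * ((ℓ + 1 : ℕ) : ℝ) * (BD + CP * ((ℓ + 1 : ℕ) : ℝ) * BG * max c 0)) := ⟨_, rfl⟩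
  have hB₄le : B₄ ≤ B₄s := by rw [hB₄sdef]; exact le_max_left _ _
  have hBder : ϱ * ((ℓ + 1 : ℕ) : ℝ) * (BD + CP * ((ℓ + 1 : ℕ) : ℝ) * BG * max c 0) ≤ B₄s := by rw [hB₄sdef]; exact le_max_right _ _
  have hB₄s0 : 0 ≤ B₄s := hB₄.trans hB₄le
  obtain ⟨M₁s, hM₁sdef⟩ : ∃ M₁s : ℝ, M₁s = max M₁ (max Mth ML) := ⟨_, rfl⟩
  have hM₁le : M₁ ≤ M₁s := by rw [hM₁sdef]; exact le_max_left _ _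
  have hMth : Mth ≤ M₁s := by rw [hM₁sdef]; exact (le_max_left _ _).trans (le_max_right _ _)
  have hML : ML ≤ M₁s := by rw [hM₁sdef]; exact (le_max_right _ _).trans (le_max_right _ _)
  have hM₁s : 0 < M₁s := lt_of_lt_of_le hM₁ hM₁le
  -- the budget rows of `vDRDG_of_ids3152 ∕ vGDRD_of_ids3152` at (δ, α, σ) := (δG, αf, τ): δG − τ − αf·δG = δ₃ + τ, δG − τ − 2αf·δG = δ₃
  have hαδ : 0 ≤ αf * δG := by rw [hαfδ]; exact hτpos.le
  have hbud : 0 ≤ δG - τ - αf * δG := by rw [hαfδ]; linarith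
  have hδD : δG - τ - αf * δG ≤ δG := by rw [hαfδ]; linarith
  have hδ₄ : δ₃ ≤ δG - τ - 2 * (αf * δG) := by rw [hαfδ]; linarith
  -- the cut block-L² record RE-ASSEMBLED above the threshold: kept fields raised to `B₄s`, the two letters DERIVED at (B₄s, δ₃)
  have hLL2c : ∀ i : KIdx 2 ℓ hd3 hL b₀ b₁, M₁s ≤ (geo9K i).M → ∀ α₀ : ℝ, 0 < α₀ → (geo9K i).M * α₀ ≤ a₁ →
      ∀ U : (bgT3 i).Cfg, (bgT3 i).Reg335 c35 α₀ U → (bgT3 i).Reg336 c35 α₀ U →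
        Letters313L2Pc (𝔬 i) (Dd i) (Dds i) 1 (H₀ i) B₄s δ₃ (vZ i) (hvZ i) U ∧
          Letters313L2MZ (𝔬 i) (Dd i) (Dds i) 1 (H₀ i) B₄s δ₃ (vZ i) (hvZ i) U := by
    intro i hM α₀ hα₀ hMa U hU hU'
    have hMi : M₁ ≤ (geo9K i).M := hM₁le.trans hM
    obtain ⟨hk, hm⟩ := hLL2 i hMi α₀ hα₀ hMa U hU hU'
    obtain ⟨hGpT, hDvT, hPT⟩ := hT i hMi α₀ hα₀ hMa U hU hU'
    have hF := hfacts i (hMth.trans hM)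
    have hR := hrow' i (hML.trans hM)
    refine ⟨B9Thm313WholeLettersCutKept.Letters313L2Pc.of_kept (hk.mono (geoOK_geo9K i) hB₄ hB₄le le_rfl) ?_ ?_, letters313L2MZ_mono_const (geoOK_geo9K i) hB₄le hm⟩
    · exact vDRDG_of_ids3152 (geoOK_geo9K i) hF hR (h31 i hMi α₀ hα₀ hMa U hU hU') (h49 i hMi α₀ hα₀ hMa U hU hU')
        (hDGD i hMi α₀ hα₀ hMa U hU hU') (hRP i hMi α₀ hα₀ hMa U hU hU') (h152 i hMi α₀ hα₀ hMa U hU hU') hGpT hDvT hPT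
        hϱ hBG hCP hBD hc' hτpos.le hαδ le_rfl le_rfl hbud hδD hBder hδ₄
    · exact vGDRD_of_ids3152 (geoOK_geo9K i) hF hR (h31 i hMi α₀ hα₀ hMa U hU hU') (h49 i hMi α₀ hα₀ hMa U hU hU')
        (hDGD i hMi α₀ hα₀ hMa U hU hU') (hRP i hMi α₀ hα₀ hMa U hU hU') (h152 i hMi α₀ hα₀ hMa U hU hU') hGpT hDvT hPT
        hϱ hBG hCP hBD hc' hτpos.le hαδ le_rfl le_rfl hbud hδD hBder hδ₄
  -- the parent leaf BY NAME at (B₄s, M₁s); every displayed row above M₁ restricts to M₁s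
  exact t313_of_pins_T3_completePairMBCZcU 𝔬 H₀ GG bH 𝔭 bHX Gp bXH Dd Dds bHW ev evY
    r Cev θ₁ θD θ₂ r₁ B₀ B₂ B₄s δ₀ δK σ ρ a₁ M₁s B₃ δ₃ ρ' α κ₀ Bh Bi Bq BhD Bx Bd θH θI θV Br Bi2 Bd2
    hθ₁ hθD hθH hθI hθ₂ hθV hr₁ hB₀ hB₂ hB₃ hB₄s0 hBr hσ hρ' hρ'ρ hρ'ρ₅ hσρ' hρS hρ₃ hρδ ha₁ hM₁s hα0 hα1 hBi hBd hBi2 hBd2 hBh hBq hBhD hBx hCev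
    hκ hκW hκX hcoR hco1R hcoG (fun i hM => hsymGG i (hM₁le.trans hM)) hl2N hH1N hIF
    (fun i hM => hmodel i (hM₁le.trans hM)) (fun i hM => hleft i (hM₁le.trans hM)) wZ hwZ
    (fun i hM => hletters i (hM₁le.trans hM)) (fun i hM => h152 i (hM₁le.trans hM)) (fun i hM => hlettersD i (hM₁le.trans hM))
    (fun i hM => hG0C i (hM₁le.trans hM)) (fun i hM => hstepD i (hM₁le.trans hM)) (fun i hM => hLHH i (hM₁le.trans hM))
    (fun i hM => hLH3 i (hM₁le.trans hM)) (fun i hM => hG0L2 i (hM₁le.trans hM)) (fun i hM => hstepL2 i (hM₁le.trans hM)) vZ hvZ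
    hLL2c (fun i hM => hLIM i (hM₁le.trans hM)) HasRWExp PosDefK hpinE hpinK

end Summit.QuantumFields.YangMills.Theorems.Prop7SectET3N06LeavesRecordCutKeptCU

end
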